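import Mathlib
import HarnessLib
import Literature.Computability.AlgebraicComplexity.AlmanLi2026SpectrumMatMul
import Summits.MatrixMultiplication.MatrixMultiplication.Theorems.OutsiderSandwichBlockNormalForm
import Summits.MatrixMultiplication.MatrixMultiplication.Theorems.OutsiderSandwichBlock
import Summits.MatrixMultiplication.MatrixMultiplication.Theorems.OutsiderSandwichExchangeSpectral
import Summits.MatrixMultiplication.MatrixMultiplication.Theorems.OutsiderSandwichExchangeLevelTwo

/-!
# Outsider sandwich — the GLUING GAIN of a spectral point (decomp-mm lens-4, g21, part 1/3)

Lens «minimal-counterexample / extremal reduction», generation 21, supporting item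
`stmt-MatrixMultiplication-27147` (`Theses.OutsiderSandwich.BlockOneIsMM`, the ω-free leaf
`∀ universal F, F⟨2,2,2⟩ ≤ F(C₁)` of the held β cut; cut of record `LaserTangency ∧ LaserMergeOptimal`
UNCHANGED).  By g20 the minimal counterexample to the leaf is ONE universal spectral point `F` with
`logRatio F = log₂(F⟨2,2,2⟩/F(C₁)) > 0`.  This part puts `F(C₁)` itself into normal form
(`θᵢ = specMMPoint ℂ F i`, `F⟨n,m,p⟩ = n^{θ₀} m^{θ₁} p^{θ₂}`, `τ_F = Σθᵢ = log₂ F⟨2,2,2⟩`):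

1. **HALF-BLOCK SANDWICH** (explicit `0/1` restriction matrices, every `n`): the pair tensor
   `pairTensor n ≅ (A; u, w) ↦ (Au, Aᵀw)` (`= C₁` for `n = 2`) is the SUM `uHalf n + wHalf n` of two
   relabelled copies of `⟨n,1,n⟩` glued along the matrix leg, so `⟨n,1,n⟩ ≤ pairTensor n ≤ ⟨n,1,n⟩ ⊕
   ⟨n,1,n⟩` and **`n^{θ₀+θ₂} = F⟨n,1,n⟩ ≤ F(pairTensor n) ≤ 2·n^{θ₀+θ₂}`**; for `C₁`:
   **`2^{θ₀+θ₂} ≤ F(C₁) ≤ 2^{1+θ₀+θ₂}`** (`rpow_le_map_coupling₁`, `map_coupling₁_le_two_mul_rpow`).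
2. **THE GLUING GAIN `gain F := log₂ F(C₁) − θ₀ − θ₂ ∈ [0, 1]`** — what a point sees of the second half
   beyond the shared matrix leg.  **`logRatio F = θ₁ − gain F`** (`logRatio_eq`); **leaf at `F` ⟺
   `θ₁(F) ≤ gain F`**; `BlockOneIsMM ⟺ ∀F, θ₁ ≤ gain F` (`blockOneIsMM_iff_gain`); the s-direction
   `BlockBelowMM ⟺ ∀F, gain F ≤ θ₁`; `C₁ ≍ ⟨2,2,2⟩ ⟺ gain ≡ θ₁`; pointwise
   `gain F ≥ max(2 − θ₀ − θ₂, θ₁ − 1/2)` (subrank floor, level-two rung), so the leaf holds on the plane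
   `τ_F = 2`.  Parts 2/3 (`OutsiderSandwichGluingBudget`, `OutsiderSandwichGluingExtremal`): the rotation
   budget `gain F + gain F_C + gain F_{CC} ≥ 2`, attainment of `θ⋆`, and `2^ω ≤ 2^{θ⋆} R̃(C₁)`.

[Strassen1988, Thm. 3.8]; [ChristandlVranaZuiddam2023, §1.1]; [AlmanLi2026, Prop. 4.1–4.2];
[Strassen1991, Thm. 6.1]; [Blaser2013, Def. 7.2].
-/

noncomputable section

open Literature.Computability.AlgebraicComplexity
open Summit.MatrixMultiplication.MatrixMultiplication.Theorems.OutsiderSandwichCoupling (coupling₁)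
open Summit.MatrixMultiplication.MatrixMultiplication.Theorems.OutsiderSandwichBlockNormalForm
  (pairTensor map_coupling₁_eq_map_pairTensor)
open Summit.MatrixMultiplication.MatrixMultiplication.Theorems.OutsiderSandwichBlock
  (map_matMulTensor_pos)
open Summit.MatrixMultiplication.MatrixMultiplication.Theorems.OutsiderSandwichExchangeSpectral
open Summit.MatrixMultiplication.MatrixMultiplication.Theorems.OutsiderSandwichExchangeLevelTwo
  (sum_specMMPoint_le_half_add_logb)

namespace Summit.MatrixMultiplication.MatrixMultiplication.Theorems.OutsiderSandwichGluingGain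

/-! ## 0. Two restriction tools -/

section Tools

variable {K : Type} [CommSemiring K] {ι κ μ ι' κ' μ' : Type} [Fintype ι] [Fintype κ] [Fintype μ]
  [DecidableEq ι] [DecidableEq κ] [DecidableEq μ]

/-- **Masked zeroing-out along index maps is a restriction**: `t ≥ [P × Q × R] · (t ∘ (f × g × h))`
(the `0/1` matrices of `tensorRestrictsTo_precomp` with the rows outside the masks zeroed).
[cite: Blaser2013, Def. 7.2] -/
theorem tensorRestrictsTo_maskedPrecomp (t : ι → κ → μ → K) (f : ι' → ι) (g : κ' → κ)
    (h : μ' → μ) (P : ι' → Prop) (Q : κ' → Prop) (R : μ' → Prop) [DecidablePred P]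
    [DecidablePred Q] [DecidablePred R] :
    TensorRestrictsTo t (fun a b c => if P a ∧ Q b ∧ R c then t (f a) (g b) (h c) else 0) := by
  refine ⟨fun a' a => if P a' ∧ f a' = a then 1 else 0, fun b' b => if Q b' ∧ g b' = b then 1 else 0,
    fun c' c => if R c' ∧ h c' = c then 1 else 0, fun a' b' c' => ?_⟩
  rw [Finset.sum_eq_single (f a') (fun a _ ha => by simp [Ne.symm ha]) (by simp),
    Finset.sum_eq_single (g b') (fun b _ hb => by simp [Ne.symm hb]) (by simp),
    Finset.sum_eq_single (h c') (fun c _ hc => by simp [Ne.symm hc]) (by simp)]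
  by_cases hP : P a' <;> by_cases hQ : Q b' <;> by_cases hR : R c' <;> simp [hP, hQ, hR]

omit [DecidableEq ι] [DecidableEq κ] [DecidableEq μ] in
/-- **`s ⊕ t ≥ s + t`** (codiagonal restriction; the tree's
`SoloInformedTriangularThreeUpper.directSumTensor_restrictsTo_add`, re-proved here to keep this file
inside the OutsiderSandwich import closure). [cite: ChristandlVranaZuiddam2023, §1.1] -/
theorem directSumTensor_restrictsTo_add' [DecidableEq ι] [DecidableEq κ] [DecidableEq μ]
    (s t : ι → κ → μ → K) : TensorRestrictsTo (directSumTensor s t) (s + t) := by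
  refine ⟨fun a' x => Sum.elim (fun a => if a = a' then 1 else 0) (fun a => if a = a' then 1 else 0) x,
    fun b' y => Sum.elim (fun b => if b = b' then 1 else 0) (fun b => if b = b' then 1 else 0) y,
    fun c' z => Sum.elim (fun c => if c = c' then 1 else 0) (fun c => if c = c' then 1 else 0) z,
    fun a' b' c' => ?_⟩
  simp only [Fintype.sum_sum_type, Sum.elim_inl, Sum.elim_inr, directSumTensor_inl,
    directSumTensor_inr, directSumTensor_inl_inr, directSumTensor_inr_inl, mul_zero,
    Finset.sum_const_zero, add_zero, zero_add]
  have h₁ : ∀ (T : ι → κ → μ → K), (∑ a, ∑ b, ∑ c, (if a = a' then (1 : K) else 0) *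
      (if b = b' then 1 else 0) * (if c = c' then 1 else 0) * T a b c) = T a' b' c' := by
    intro T
    rw [Finset.sum_eq_single a' (fun a _ ha => by simp [ha]) (by simp),
      Finset.sum_eq_single b' (fun b _ hb => by simp [hb]) (by simp),
      Finset.sum_eq_single c' (fun c _ hc => by simp [hc]) (by simp)]
    simp
  have h₂ : (∑ a : ι, ∑ b : κ, ∑ c : μ, (if a = a' then (1 : K) else 0) *
      (if b = b' then 1 else 0) * (if c = c' then 1 else 0) *
        directSumTensor s t (Sum.inl a) (Sum.inl b) (Sum.inr c)) = 0 :=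
    Finset.sum_eq_zero fun a _ => Finset.sum_eq_zero fun b _ => Finset.sum_eq_zero fun c _ => by
      simp [directSumTensor]
  have h₃ : (∑ a : ι, ∑ b : κ, ∑ c : μ, (if a = a' then (1 : K) else 0) *
      (if b = b' then 1 else 0) * (if c = c' then 1 else 0) *
        directSumTensor s t (Sum.inr a) (Sum.inr b) (Sum.inl c)) = 0 :=
    Finset.sum_eq_zero fun a _ => Finset.sum_eq_zero fun b _ => Finset.sum_eq_zero fun c _ => by
      simp [directSumTensor]
  simp only [Finset.sum_add_distrib]
  rw [h₁ s, h₁ t, h₂, h₃, Pi.add_apply, Pi.add_apply, Pi.add_apply]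
  ring

end Tools

/-! ## 1. The two halves of the pair tensor are `⟨n,1,n⟩` -/

/-- The `u ↦ Au` half of `pairTensor n`: entry `1` at `((r,c), (0,c), (1,r))`. -/
def uHalf (n : ℕ) : Fin n × Fin n → Fin 2 × Fin n → Fin 2 × Fin n → ℂ :=
  fun a y z => if y.1 = 0 ∧ z.1 = 1 ∧ y.2 = a.2 ∧ z.2 = a.1 then 1 else 0

/-- The `w ↦ Aᵀw` half of `pairTensor n`: entry `1` at `((r,c), (1,r), (0,c))`. -/
def wHalf (n : ℕ) : Fin n × Fin n → Fin 2 × Fin n → Fin 2 × Fin n → ℂ :=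
  fun a y z => if y.1 = 1 ∧ z.1 = 0 ∧ y.2 = a.1 ∧ z.2 = a.2 then 1 else 0

/-- **`pairTensor n = uHalf n + wHalf n`** (the two halves have disjoint supports). -/
theorem pairTensor_eq_add (n : ℕ) : pairTensor n = uHalf n + wHalf n := by
  funext a y z
  obtain ⟨y₁, y₂⟩ := y
  obtain ⟨z₁, z₂⟩ := z
  simp only [pairTensor, uHalf, wHalf, Pi.add_apply]
  fin_cases y₁ <;> fin_cases z₁ <;> simp

/-- `wHalf n` is `⟨n,1,n⟩` zeroed-out/relabelled: `⟨n,1,n⟩ ≥ wHalf n`. [cite: Blaser2013, Def. 7.2] -/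
theorem matMul_restrictsTo_wHalf (n : ℕ) : TensorRestrictsTo (matMulTensor ℂ n 1 n) (wHalf n) := by
  have e : wHalf n = fun a y z => if True ∧ y.1 = 1 ∧ z.1 = 0 then
      matMulTensor ℂ n 1 n a (y.2, (0 : Fin 1)) ((0 : Fin 1), z.2) else 0 := by
    funext a y z
    simp only [wHalf, matMulTensor, true_and]
    by_cases h1 : y.1 = 1 <;> by_cases h2 : z.1 = 0 <;> simp [h1, h2, eq_comm]
  rw [e]
  exact tensorRestrictsTo_maskedPrecomp _ _ _ _ _ _ _

/-- `uHalf n` is `⟨n,1,n⟩` zeroed-out/relabelled (matrix leg read transposed): `⟨n,1,n⟩ ≥ uHalf n`.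
[cite: Blaser2013, Def. 7.2] -/
theorem matMul_restrictsTo_uHalf (n : ℕ) : TensorRestrictsTo (matMulTensor ℂ n 1 n) (uHalf n) := by
  have e : uHalf n = fun a y z => if True ∧ y.1 = 0 ∧ z.1 = 1 then
      matMulTensor ℂ n 1 n (a.2, a.1) (y.2, (0 : Fin 1)) ((0 : Fin 1), z.2) else 0 := by
    funext a y z
    simp only [uHalf, matMulTensor, true_and]
    by_cases h1 : y.1 = 0 <;> by_cases h2 : z.1 = 1 <;> simp [h1, h2, eq_comm]
  rw [e]
  exact tensorRestrictsTo_maskedPrecomp _ _ _ _ _ _ _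

/-- Conversely `wHalf n ≥ ⟨n,1,n⟩` (relabelling). [cite: Blaser2013, Def. 7.2] -/
theorem wHalf_restrictsTo_matMul (n : ℕ) : TensorRestrictsTo (wHalf n) (matMulTensor ℂ n 1 n) := by
  have e : matMulTensor ℂ n 1 n = fun a b c => wHalf n a ((1 : Fin 2), b.1) ((0 : Fin 2), c.2) := by
    funext a b c
    obtain ⟨b₁, b₂⟩ := b
    obtain ⟨c₁, c₂⟩ := c
    have hb : b₂ = c₁ := Subsingleton.elim _ _
    subst hb
    simp [wHalf, matMulTensor, eq_comm]
  rw [e]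
  exact tensorRestrictsTo_precomp _ _ _ _

/-- Conversely `uHalf n ≥ ⟨n,1,n⟩` (relabelling). [cite: Blaser2013, Def. 7.2] -/
theorem uHalf_restrictsTo_matMul (n : ℕ) : TensorRestrictsTo (uHalf n) (matMulTensor ℂ n 1 n) := by
  have e : matMulTensor ℂ n 1 n =
      fun a b c => uHalf n (a.2, a.1) ((0 : Fin 2), b.1) ((1 : Fin 2), c.2) := by
    funext a b c
    obtain ⟨b₁, b₂⟩ := b
    obtain ⟨c₁, c₂⟩ := c
    have hb : b₂ = c₁ := Subsingleton.elim _ _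
    subst hb
    simp [uHalf, matMulTensor, eq_comm]
  rw [e]
  exact tensorRestrictsTo_precomp _ _ _ _

/-- **`pairTensor n ≥ ⟨n,1,n⟩`** (keep the `w ↦ Aᵀw` half). [cite: Blaser2013, Def. 7.2] -/
theorem pairTensor_restrictsTo_matMul (n : ℕ) :
    TensorRestrictsTo (pairTensor n) (matMulTensor ℂ n 1 n) := by
  have e : matMulTensor ℂ n 1 n =
      fun a b c => pairTensor n a ((1 : Fin 2), b.1) ((0 : Fin 2), c.2) := by
    funext a b c
    obtain ⟨b₁, b₂⟩ := b
    obtain ⟨c₁, c₂⟩ := c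
    have hb : b₂ = c₁ := Subsingleton.elim _ _
    subst hb
    simp [pairTensor, matMulTensor, eq_comm]
  rw [e]
  exact tensorRestrictsTo_precomp _ _ _ _

/-- **`uHalf n ⊕ wHalf n ≥ pairTensor n`** (glue the two halves along the matrix leg).
[cite: ChristandlVranaZuiddam2023, §1.1] -/
theorem directSum_halves_restrictsTo_pairTensor (n : ℕ) :
    TensorRestrictsTo (directSumTensor (uHalf n) (wHalf n)) (pairTensor n) := by
  rw [pairTensor_eq_add]
  exact directSumTensor_restrictsTo_add' _ _

/-! ## 2. Values at universal points: the half-block sandwich -/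

variable {F : SpectralMap ℂ}

/-- `F(wHalf n) = F⟨n,1,n⟩`. [cite: Strassen1988, Thm. 3.8] -/
theorem map_wHalf (hF : IsUniversalSpectralPoint ℂ F) (n : ℕ) :
    F (wHalf n) = F (matMulTensor ℂ n 1 n) :=
  le_antisymm (hF.mono _ _ (matMul_restrictsTo_wHalf n)) (hF.mono _ _ (wHalf_restrictsTo_matMul n))

/-- `F(uHalf n) = F⟨n,1,n⟩`. [cite: Strassen1988, Thm. 3.8] -/
theorem map_uHalf (hF : IsUniversalSpectralPoint ℂ F) (n : ℕ) :
    F (uHalf n) = F (matMulTensor ℂ n 1 n) :=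
  le_antisymm (hF.mono _ _ (matMul_restrictsTo_uHalf n)) (hF.mono _ _ (uHalf_restrictsTo_matMul n))

/-- `F⟨n,1,n⟩ = n^{θ₀+θ₂}` (`n ≥ 1`). [cite: AlmanLi2026, Prop. 4.1] -/
theorem map_matMul_n1n (hF : IsUniversalSpectralPoint ℂ F) {n : ℕ} (hn : 1 ≤ n) :
    F (matMulTensor ℂ n 1 n) = (n : ℝ) ^ (specMMPoint ℂ F 0 + specMMPoint ℂ F 2) := by
  rw [AlmanLi2026.prop41 hF hn le_rfl hn, Nat.cast_one, Real.one_rpow, mul_one,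
    Real.rpow_add (by exact_mod_cast hn)]

/-- `F⟨2,1,2⟩ = 2^{θ₀+θ₂}`. [cite: AlmanLi2026, Prop. 4.1] -/
theorem map_matMul_212 (hF : IsUniversalSpectralPoint ℂ F) :
    F (matMulTensor ℂ 2 1 2) = (2 : ℝ) ^ (specMMPoint ℂ F 0 + specMMPoint ℂ F 2) := by
  have h := map_matMul_n1n hF (n := 2) (by norm_num)
  exact_mod_cast h

/-- **Lower half of the sandwich: `F⟨n,1,n⟩ ≤ F(pairTensor n)`.** [cite: Strassen1988, Thm. 3.8] -/
theorem map_matMul_le_map_pairTensor (hF : IsUniversalSpectralPoint ℂ F) (n : ℕ) :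
    F (matMulTensor ℂ n 1 n) ≤ F (pairTensor n) :=
  hF.mono _ _ (pairTensor_restrictsTo_matMul n)

/-- **Upper half of the sandwich: `F(pairTensor n) ≤ 2 · F⟨n,1,n⟩`.** [cite: Strassen1988, Thm. 3.8] -/
theorem map_pairTensor_le (hF : IsUniversalSpectralPoint ℂ F) (n : ℕ) :
    F (pairTensor n) ≤ 2 * F (matMulTensor ℂ n 1 n) :=
  calc F (pairTensor n) ≤ F (directSumTensor (uHalf n) (wHalf n)) :=
        hF.mono _ _ (directSum_halves_restrictsTo_pairTensor n)
    _ = F (uHalf n) + F (wHalf n) := hF.map_directSum _ _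
    _ = 2 * F (matMulTensor ℂ n 1 n) := by rw [map_uHalf hF, map_wHalf hF]; ring

/-- **`2^{θ₀+θ₂} ≤ F(C₁)`** (`C₁ ≅ pairTensor 2 ≥ ⟨2,1,2⟩`). [cite: AlmanLi2026, Prop. 4.1] -/
theorem rpow_le_map_coupling₁ (hF : IsUniversalSpectralPoint ℂ F) :
    (2 : ℝ) ^ (specMMPoint ℂ F 0 + specMMPoint ℂ F 2) ≤ F coupling₁ := by
  rw [map_coupling₁_eq_map_pairTensor hF, ← map_matMul_212 hF]
  exact map_matMul_le_map_pairTensor hF 2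

/-- **`F(C₁) ≤ 2 · 2^{θ₀+θ₂} = 2 F⟨2,1,2⟩`** (tight at every point with `θ₁ = 1`, where both sides
are `4`). [cite: AlmanLi2026, Prop. 4.1] -/
theorem map_coupling₁_le_two_mul_rpow (hF : IsUniversalSpectralPoint ℂ F) :
    F coupling₁ ≤ 2 * (2 : ℝ) ^ (specMMPoint ℂ F 0 + specMMPoint ℂ F 2) := by
  rw [map_coupling₁_eq_map_pairTensor hF, ← map_matMul_212 hF]
  exact map_pairTensor_le hF 2

/-! ## 3. The gluing gain -/

/-- **The gluing gain `gain F := log₂ F(C₁) − (θ₀ + θ₂)(F)`**: `F(C₁) = 2^{gain F} · F⟨2,1,2⟩`.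
[cite: Strassen1988, Thm. 3.8] -/
def gain (F : SpectralMap ℂ) : ℝ :=
  Real.logb 2 (F coupling₁) - (specMMPoint ℂ F 0 + specMMPoint ℂ F 2)

/-- `log₂ F(C₁) = gain F + θ₀ + θ₂`. [folklore] -/
theorem logb_map_coupling₁_eq (F : SpectralMap ℂ) :
    Real.logb 2 (F coupling₁) = gain F + specMMPoint ℂ F 0 + specMMPoint ℂ F 2 := by
  unfold gain; ring

/-- `0 < F(C₁)`. [folklore] -/
theorem map_coupling₁_pos (hF : IsUniversalSpectralPoint ℂ F) : 0 < F coupling₁ :=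
  lt_of_lt_of_le (by norm_num) (four_le_map_coupling₁ hF)

/-- `log₂ F⟨2,2,2⟩ = θ₀ + θ₁ + θ₂`. [cite: AlmanLi2026, Prop. 4.2] -/
theorem logb_map_matMul_eq (hF : IsUniversalSpectralPoint ℂ F) :
    Real.logb 2 (F (matMulTensor ℂ 2 2 2)) =
      specMMPoint ℂ F 0 + specMMPoint ℂ F 1 + specMMPoint ℂ F 2 := by
  rw [map_matMul_eq_rpow hF, Real.logb_rpow (by norm_num) (by norm_num), Fin.sum_univ_three]

/-- **`0 ≤ gain F`.** [cite: AlmanLi2026, Prop. 4.1] -/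
theorem gain_nonneg (hF : IsUniversalSpectralPoint ℂ F) : 0 ≤ gain F := by
  have h := Real.logb_le_logb_of_le one_lt_two (Real.rpow_pos_of_pos two_pos _)
    (rpow_le_map_coupling₁ hF)
  rw [Real.logb_rpow two_pos (by norm_num)] at h
  unfold gain
  linarith

/-- **`gain F ≤ 1`.** [cite: AlmanLi2026, Prop. 4.1] -/
theorem gain_le_one (hF : IsUniversalSpectralPoint ℂ F) : gain F ≤ 1 := by
  have h := map_coupling₁_le_two_mul_rpow hF
  have e : 2 * (2 : ℝ) ^ (specMMPoint ℂ F 0 + specMMPoint ℂ F 2) =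
      (2 : ℝ) ^ (1 + (specMMPoint ℂ F 0 + specMMPoint ℂ F 2)) := by
    rw [Real.rpow_add two_pos 1, Real.rpow_one]
  rw [e] at h
  have h' := Real.logb_le_logb_of_le one_lt_two (map_coupling₁_pos hF) h
  rw [Real.logb_rpow two_pos (by norm_num)] at h'
  unfold gain
  linarith

/-- `2 − θ₀ − θ₂ ≤ gain F` (the floor `4 ≤ F(C₁)`, i.e. `Q̃(C₁) = 4`). [cite: Strassen1991, Thm. 6.1] -/
theorem two_sub_le_gain (hF : IsUniversalSpectralPoint ℂ F) :
    2 - (specMMPoint ℂ F 0 + specMMPoint ℂ F 2) ≤ gain F := by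
  have h := Real.logb_le_logb_of_le one_lt_two (by norm_num) (four_le_map_coupling₁ hF)
  have h4 : Real.logb 2 (4 : ℝ) = 2 := by
    rw [show (4 : ℝ) = 2 ^ (2 : ℕ) by norm_num, Real.logb_pow, Real.logb_self_eq_one one_lt_two]
    norm_num
  rw [h4] at h
  unfold gain
  linarith

/-- **`logRatio F = θ₁(F) − gain F`**: the exchange defect of a point is its middle letter minus its
gluing gain. [cite: AlmanLi2026, Prop. 4.2] -/
theorem logRatio_eq (hF : IsUniversalSpectralPoint ℂ F) :
    logRatio F = specMMPoint ℂ F 1 - gain F := by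
  rw [logRatio_eq_sum_specMMPoint_sub hF, Fin.sum_univ_three]
  unfold gain
  ring

/-- **The leaf at `F` ⟺ `θ₁(F) ≤ gain F`.** [cite: Strassen1988, Thm. 3.8] -/
theorem le_iff_le_gain (hF : IsUniversalSpectralPoint ℂ F) :
    F (matMulTensor ℂ 2 2 2) ≤ F coupling₁ ↔ specMMPoint ℂ F 1 ≤ gain F := by
  have h := logRatio_le_iff hF (θ := 0)
  rw [Real.rpow_zero, one_mul] at h
  rw [← h, logRatio_eq hF, sub_nonpos]

/-- **`BlockOneIsMM ⟺ ∀ universal F, θ₁(F) ≤ gain F`.** [cite: Strassen1988, Thm. 3.8] -/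
theorem blockOneIsMM_iff_gain :
    Theses.OutsiderSandwich.BlockOneIsMM ↔
      ∀ F : SpectralMap ℂ, IsUniversalSpectralPoint ℂ F → specMMPoint ℂ F 1 ≤ gain F := by
  rw [blockOneIsMM_iff_spectralRatioLe_zero, spectralRatioLe_zero_iff]
  exact forall₂_congr fun _ hF => le_iff_le_gain hF

/-- `F(C₁) ≤ F⟨2,2,2⟩ ⟺ gain F ≤ θ₁(F)` (the s-direction at a point). [cite: Strassen1988, Thm. 3.8] -/
theorem ge_iff_gain_le (hF : IsUniversalSpectralPoint ℂ F) :
    F coupling₁ ≤ F (matMulTensor ℂ 2 2 2) ↔ gain F ≤ specMMPoint ℂ F 1 := by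
  rw [← Real.logb_le_logb one_lt_two (map_coupling₁_pos hF) (map_matMulTensor_pos hF),
    logb_map_coupling₁_eq, logb_map_matMul_eq hF]
  constructor <;> intro h <;> linarith

/-- **`BlockBelowMM ⟺ ∀ universal F, gain F ≤ θ₁(F)`.** [cite: Strassen1988, Thm. 3.8] -/
theorem blockBelowMM_iff_gain :
    Theses.OutsiderSandwich.BlockBelowMM ↔
      ∀ F : SpectralMap ℂ, IsUniversalSpectralPoint ℂ F → gain F ≤ specMMPoint ℂ F 1 :=
  forall₂_congr fun _ hF => ge_iff_gain_le hF

/-- **`C₁ ≍ ⟨2,2,2⟩` (both ω-free one-block statements) ⟺ `gain ≡ θ₁` on the spectrum.**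
[cite: Strassen1988, Thm. 3.8] -/
theorem blockOneIsMM_and_blockBelowMM_iff_gain_eq :
    (Theses.OutsiderSandwich.BlockOneIsMM ∧ Theses.OutsiderSandwich.BlockBelowMM) ↔
      ∀ F : SpectralMap ℂ, IsUniversalSpectralPoint ℂ F → gain F = specMMPoint ℂ F 1 := by
  rw [blockOneIsMM_iff_gain, blockBelowMM_iff_gain]
  constructor
  · rintro ⟨h₁, h₂⟩ F hF
    exact le_antisymm (h₂ F hF) (h₁ F hF)
  · intro h
    exact ⟨fun F hF => (h F hF).ge, fun F hF => (h F hF).le⟩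

/-- **`θ₁(F) − 1/2 ≤ gain F`** (the effective level-two rung `F⟨2,2,2⟩² ≤ 2F(C₁)²` in gain form).
[cite: Strassen1988, Thm. 3.8] -/
theorem sub_half_le_gain (hF : IsUniversalSpectralPoint ℂ F) :
    specMMPoint ℂ F 1 - 1 / 2 ≤ gain F := by
  have h := sum_specMMPoint_le_half_add_logb hF
  rw [Fin.sum_univ_three, logb_map_coupling₁_eq] at h
  linarith

/-- **The leaf holds on the plane `τ_F = 2`** (`gain ≥ 2 − θ₀ − θ₂ = θ₁` there). [cite: AlmanLi2026, Prop. 4.2] -/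
theorem le_of_sum_eq_two (hF : IsUniversalSpectralPoint ℂ F) (hτ : ∑ i, specMMPoint ℂ F i = 2) :
    F (matMulTensor ℂ 2 2 2) ≤ F coupling₁ := by
  rw [le_iff_le_gain hF]
  rw [Fin.sum_univ_three] at hτ
  have h := two_sub_le_gain hF
  linarith

/-- `logRatio F = log₂ F⟨2,2,2⟩ − log₂ F(C₁)`. [folklore] -/
theorem logRatio_eq_logb_sub (hF : IsUniversalSpectralPoint ℂ F) :
    logRatio F = Real.logb 2 (F (matMulTensor ℂ 2 2 2)) - Real.logb 2 (F coupling₁) := by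
  rw [logRatio, Real.logb_div (map_matMulTensor_pos hF).ne' (map_coupling₁_pos hF).ne']

end Summit.MatrixMultiplication.MatrixMultiplication.Theorems.OutsiderSandwichGluingGain

end
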